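import Mathlib
import Literature.NumberTheory.LFunctions.Zhang2022.RepairBedAssumptionAVacuousRange
import HarnessLib

/-!
# Zhang (2022), rescue bed (D-0124 (3)) honesty rule H2: the range pushed to the CROSSOVER of the trivial bound —
# Assumption (A) is false for every real primitive character of conductor `≤ e^{43149}`

Topic `Literature/NumberTheory/LFunctions/Zhang2022` (Landau–Siegel audit tree; verdict-neutral).
Y. Zhang, *Discrete mean estimates and the Landau–Siegel zero*, arXiv:2211.02515v1 (2022)
[Zhang2022LandauSiegel] — **an unrefereed manuscript under adjudication; nothing in this file asserts or
denies its Theorems 1–2, and nothing here is a claim about Landau–Siegel zeros. The programme SEARCHES and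
TYPES; no claim about Landau–Siegel zeros, Theorems 1–2 of arXiv:2211.02515 or a repaired Margin232 until a
kernel theorem says so.**

`RepairBedAssumptionAVacuousRange` refutes `Skeleton.AssumptionA q χ := ‖L(1,χ)‖ < 1/(log q)^2022` for every
primitive quadratic `χ` of modulus `1 < q` with `log q ≤ 40 440`, by the floor `L(1,χ_D) ≥ (3/4)/√|D|` (`h ≥ 1`) and two
chords of `exp` (on `[0, 1]` and `[0, 10]`). The floor refutes (A) exactly as long as `(4/3)√q ≤ (log q)^2022`, i.e.
up to the crossover `log q* ≈ 43 159.67` (ls-rescue-ref-2 R2-B155), so the `K = 10` chord endpoint `40 440` left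
`2 719` nats of the trivial bound's range unused. This file adds the THIRD chord, between `t = 10` and `t = 10.67`
(`e^{0.67} < 1.95428` from `(e^{0.67})³ = e²·e^{0.01} ≤ 2.7182818286²/0.99`), and so covers `log q ≤ 43 149 = 4044·10.67`
— within 11 nats of the crossover; beyond it the trivial bound says nothing and neither does this tree:

* (private) `exp_le_chord₂`, `exp_067_lt`, `mul_exp_div_le_third` (`1.0002·e^{u/4044} ≤ u` on `[40 440, 43 149]`),
  `one_div_log_pow_le_third` (`1/(log D)^2022 ≤ (3/4)/√D` for `40 440 ≤ log D ≤ 43 149`);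
* `not_assumptionA_of_re_ge_sqrt'` (any `χ (mod D)`, `3 ≤ D`, `log D ≤ 43 149`, `Re L(1,χ) ≥ (3/4)/√D`),
  `not_assumptionA_kroneckerChar_of_log_natAbs_le'` (every fundamental `D`, `log|D| ≤ 43 149`),
  **`not_assumptionA_of_isPrimitive_isQuadratic_of_log_le'`** (every primitive quadratic `χ (mod q)`, `1 < q`,
  `log q ≤ 43 149`).

So the bed's (H2) sentence reads, in the kernel: (A) is refuted pointwise for every primitive quadratic Dirichlet
character of modulus `1 < q ≤ e^{43149}` — the range of the trivial bound `h ≥ 1` up to 11 nats below its crossover;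
nothing about (A) beyond, which is the manuscript's subject. Theorems only; no definition, no named fact.

## References

* Y. Zhang, arXiv:2211.02515v1 (2022), §2 Assumption (A) p. 4. [cite: Zhang2022LandauSiegel, §2 Assumption (A)]
* H. Davenport, *Multiplicative Number Theory*, 2nd ed. (1980), Ch. 6. [cite: DavenportMNT1980, Ch. 6]
* H. L. Montgomery, R. C. Vaughan, *Multiplicative Number Theory I*, CUP 2007, Theorem 9.13.
  [cite: MontgomeryVaughan2007, Theorem 9.13]
-/

noncomputable section

open Complex Real DirichletCharacter

namespace Literature.NumberTheory.LFunctions.Zhang2022.Repair.Bed.Vacuity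

open Skeleton Literature.NumberTheory.LFunctions.Zhang2022.Repair.Bed
open Literature.NumberTheory.LFunctions.KroneckerCharacter
open Literature.NumberTheory.QuadraticFields

/-! ## The third chord: `[10, 10.67]` -/

/-- Two-point chord bound for the convex function `exp` on `[a, b]`:
`exp t ≤ ((b − t)·e^a + (t − a)·e^b)/(b − a)`. [folklore] -/
private theorem exp_le_chord₂ {a b t : ℝ} (hab : a < b) (ha : a ≤ t) (hb : t ≤ b) :
    Real.exp t ≤ ((b - t) * Real.exp a + (t - a) * Real.exp b) / (b - a) := by
  have hba : 0 < b - a := sub_pos.mpr hab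
  have hw1 : 0 ≤ (b - t) / (b - a) := div_nonneg (by linarith) hba.le
  have hw2 : 0 ≤ (t - a) / (b - a) := div_nonneg (by linarith) hba.le
  have hsum : (b - t) / (b - a) + (t - a) / (b - a) = 1 := by
    field_simp; ring
  have h := convexOn_exp.2 (Set.mem_univ a) (Set.mem_univ b) hw1 hw2 hsum
  simp only [smul_eq_mul] at h
  have ht : (b - t) / (b - a) * a + (t - a) / (b - a) * b = t := by
    field_simp; ring
  rw [ht] at h
  calc Real.exp t ≤ (b - t) / (b - a) * Real.exp a + (t - a) / (b - a) * Real.exp b := h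
    _ = ((b - t) * Real.exp a + (t - a) * Real.exp b) / (b - a) := by
      field_simp

/-- `e^{10} < 22 026.47` (`e < 2.7182818286`). [folklore] -/
private theorem exp_ten_lt' : Real.exp 10 < 22026.47 := by
  have h := Real.exp_one_lt_d9
  have h0 := (Real.exp_pos 1).le
  have h10 : Real.exp 10 = Real.exp 1 ^ 10 := by
    rw [← Real.exp_nat_mul]; norm_num
  rw [h10]
  calc Real.exp 1 ^ 10 ≤ (2.7182818286 : ℝ) ^ 10 := pow_le_pow_left₀ h0 h.le 10
    _ < 22026.47 := by norm_num

/-- `e^{0.67} < 1.95428` (`(e^{0.67})³ = e^{2.01} = e²·e^{0.01}`, `e < 2.7182818286`, `e^{0.01} ≤ 1/0.99`,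
`2.7182818286²/0.99 < 1.95428³`). [folklore] -/
private theorem exp_067_lt : Real.exp 0.67 < 1.95428 := by
  have h3 : Real.exp 0.67 ^ 3 = Real.exp 1 ^ 2 * Real.exp 0.01 := by
    rw [← Real.exp_nat_mul, ← Real.exp_nat_mul, ← Real.exp_add]; norm_num
  have he := Real.exp_one_lt_d9
  have he0 := (Real.exp_pos 1).le
  have h01 : Real.exp 0.01 ≤ 1 / (1 - 0.01) :=
    Real.exp_bound_div_one_sub_of_interval (by norm_num) (by norm_num)
  have hcube : Real.exp 0.67 ^ 3 < (1.95428 : ℝ) ^ 3 := by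
    rw [h3]
    have hsq : Real.exp 1 ^ 2 ≤ (2.7182818286 : ℝ) ^ 2 := pow_le_pow_left₀ he0 he.le 2
    calc Real.exp 1 ^ 2 * Real.exp 0.01 ≤ (2.7182818286 : ℝ) ^ 2 * (1 / (1 - 0.01)) :=
          mul_le_mul hsq h01 (Real.exp_pos _).le (by norm_num)
      _ < (1.95428 : ℝ) ^ 3 := by norm_num
  exact lt_of_pow_lt_pow_left₀ 3 (by norm_num) hcube

/-- **For `40 440 ≤ u ≤ 43 149`: `1.0002·e^{u/4044} ≤ u`** — the chord of `exp` between `t = 10` and `t = 10.67`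
(`t = u/4044`; `e^{10} < 22 026.47`, `e^{10.67} < 43 045.89`; the resulting affine inequality holds up to `u ≈ 43 163`).
[folklore] -/
private theorem mul_exp_div_le_third {u : ℝ} (h1 : (40440 : ℝ) ≤ u) (h2 : u ≤ 43149) :
    (1 + 0.0002) * Real.exp (u / 4044) ≤ u := by
  have ha : (10 : ℝ) ≤ u / 4044 := by rw [le_div_iff₀ (by norm_num)]; linarith
  have hb : u / 4044 ≤ 10.67 := by rw [div_le_iff₀ (by norm_num)]; linarith
  have hc := exp_le_chord₂ (a := 10) (b := 10.67) (by norm_num) ha hb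
  have h10 := exp_ten_lt'
  have h1067 : Real.exp 10.67 < 43045.89 := by
    have hsplit : Real.exp 10.67 = Real.exp 10 * Real.exp 0.67 := by
      rw [← Real.exp_add]; norm_num
    rw [hsplit]
    calc Real.exp 10 * Real.exp 0.67 ≤ 22026.47 * 1.95428 :=
          mul_le_mul h10.le exp_067_lt.le (Real.exp_pos _).le (by norm_num)
      _ < 43045.89 := by norm_num
  have hw1 : 0 ≤ 10.67 - u / 4044 := by linarith
  have hw2 : 0 ≤ u / 4044 - 10 := by linarith
  have hm1 := mul_le_mul_of_nonneg_left h10.le hw1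
  have hm2 := mul_le_mul_of_nonneg_left h1067.le hw2
  have hnum : ((10.67 - u / 4044) * Real.exp 10 + (u / 4044 - 10) * Real.exp 10.67) / (10.67 - 10) ≤
      ((10.67 - u / 4044) * 22026.47 + (u / 4044 - 10) * 43045.89) / (10.67 - 10) :=
    div_le_div_of_nonneg_right (by linarith) (by norm_num)
  have hE := hc.trans hnum
  rw [show (10.67 : ℝ) - 10 = 0.67 by norm_num] at hE
  have hpos := Real.exp_pos (u / 4044)
  have hE' := mul_le_mul_of_nonneg_left hE (show (0 : ℝ) ≤ 1 + 0.0002 by norm_num)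
  refine hE'.trans ?_
  rw [mul_div_assoc']
  rw [div_le_iff₀ (by norm_num)]
  nlinarith

/-- **For `40 440 ≤ u ≤ 43 149`: `(4/3)·e^{u/2} ≤ u^2022`** (raise the third chord to the 2022nd power; Bernoulli
`(1 + 0.0002)^2022 ≥ 4/3`). [folklore] -/
private theorem exp_half_le_pow_third {u : ℝ} (h1 : (40440 : ℝ) ≤ u) (h2 : u ≤ 43149) :
    4 / 3 * Real.exp (u / 2) ≤ u ^ 2022 := by
  have hkey := mul_exp_div_le_third h1 h2
  have hpos : 0 ≤ (1 + 0.0002) * Real.exp (u / 4044) := by positivity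
  have hpow : ((1 + 0.0002) * Real.exp (u / 4044)) ^ 2022 ≤ u ^ 2022 := pow_le_pow_left₀ hpos hkey 2022
  have hexp : Real.exp (u / 4044) ^ 2022 = Real.exp (u / 2) := by
    rw [← Real.exp_nat_mul]; congr 1; ring
  have hB : (1 : ℝ) + (2022 : ℕ) * (0.0002 : ℝ) ≤ (1 + 0.0002) ^ 2022 := one_add_mul_le_pow (by norm_num) 2022
  have h43 : (4 : ℝ) / 3 ≤ (1 + 0.0002 : ℝ) ^ 2022 := le_trans (by norm_num) hB
  calc 4 / 3 * Real.exp (u / 2) ≤ (1 + 0.0002 : ℝ) ^ 2022 * Real.exp (u / 2) :=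
        mul_le_mul_of_nonneg_right h43 (Real.exp_pos _).le
    _ = ((1 + 0.0002) * Real.exp (u / 4044)) ^ 2022 := by rw [mul_pow, hexp]
    _ ≤ u ^ 2022 := hpow

/-- **For `40 440 ≤ log D ≤ 43 149`: `1/(log D)^2022 ≤ (3/4)/√D`** (`√D = e^{(log D)/2}`). [folklore] -/
private theorem one_div_log_pow_le_third {D : ℕ} (h1 : (40440 : ℝ) ≤ Real.log D) (h2 : Real.log D ≤ 43149) :
    1 / Real.log D ^ 2022 ≤ (3 / 4 : ℝ) / Real.sqrt D := by
  have hD : (0 : ℝ) < D := by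
    rcases Nat.eq_zero_or_pos D with h | h
    · exfalso; subst h
      rw [Nat.cast_zero, Real.log_zero] at h1
      linarith
    · exact_mod_cast h
  have hmain := exp_half_le_pow_third h1 h2
  have hsq : Real.exp (Real.log D / 2) ^ 2 = D := by
    rw [← Real.exp_nat_mul]; push_cast
    rw [show (2 : ℝ) * (Real.log D / 2) = Real.log D by ring, Real.exp_log hD]
  have hsqrt : Real.sqrt D = Real.exp (Real.log D / 2) := by
    have := Real.sqrt_sq (Real.exp_pos (Real.log D / 2)).le
    rwa [hsq] at this
  have hlogpos : 0 < Real.log D := by linarith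
  have hpow : 0 < Real.log D ^ 2022 := pow_pos hlogpos _
  have hs : 0 < Real.sqrt D := Real.sqrt_pos.mpr hD
  rw [div_le_div_iff₀ hpow hs, one_mul, hsqrt]
  linarith

/-! ## The generic refutation up to `e^{43149}` -/

/-- **`Re L(1,χ) ≥ (3/4)/√D` refutes Assumption (A) at any modulus `3 ≤ D ≤ e^{43149}`**, for ANY Dirichlet character
`χ (mod D)` — `log D ≤ 40 440` by `not_assumptionA_of_re_ge_sqrt`, the slab `40 440 ≤ log D ≤ 43 149` by the third chord.
[cite: Zhang2022LandauSiegel, §2 Assumption (A)] -/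
theorem not_assumptionA_of_re_ge_sqrt' {D : ℕ} [NeZero D] (χ : DirichletCharacter ℂ D) (h3 : 3 ≤ D)
    (hlog : Real.log D ≤ 43149) (h : (3 / 4 : ℝ) / Real.sqrt D ≤ (χ.LFunction 1).re) : ¬ AssumptionA D χ := by
  rcases le_or_gt (Real.log D) 40440 with hle | hgt
  · exact not_assumptionA_of_re_ge_sqrt χ h3 hle h
  · intro hA
    unfold AssumptionA at hA
    have hre : (χ.LFunction 1).re ≤ ‖χ.LFunction 1‖ := Complex.re_le_norm _
    have hcmp := one_div_log_pow_le_third hgt.le hlog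
    linarith

/-! ## (A) is false at `χ_D` for every fundamental `|D| ≤ e^{43149}` -/

/-- The cast of `Int.natAbs` to `ℝ` is the absolute value. [folklore] -/
private theorem cast_natAbs_eq_abs' (D : ℤ) : ((D.natAbs : ℕ) : ℝ) = |(D : ℝ)| := by
  rw [← Int.cast_natCast, Int.natCast_natAbs, Int.cast_abs]

/-- **Assumption (A) is false at `χ_D = kroneckerChar D` for EVERY fundamental discriminant with `log|D| ≤ 43 149`**
(the floor `three_quarters_div_sqrt_le_LOne` and `not_assumptionA_of_re_ge_sqrt'`). Nothing about (A) for larger `D`.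
[cite: Zhang2022LandauSiegel, §2 Assumption (A)] [cite: DavenportMNT1980, Ch. 6] -/
theorem not_assumptionA_kroneckerChar_of_log_natAbs_le' {D : ℤ}
    (hfd : Literature.Barriers.RiemannHypothesis.IsFundamentalDiscriminant D) (hlog : Real.log D.natAbs ≤ 43149) :
    ∃ h0 : D ≠ 0, haveI : NeZero D.natAbs := ⟨Int.natAbs_ne_zero.mpr h0⟩
      ¬ AssumptionA D.natAbs (kroneckerChar D) := by
  have h0 : D ≠ 0 := by
    rintro rfl
    rcases hfd with ⟨h1, -, -⟩ | ⟨-, h23, -⟩ <;> omega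
  have h3 : 3 ≤ D.natAbs := by
    by_contra hlt
    have hD : D = -2 ∨ D = -1 ∨ D = 0 ∨ D = 1 ∨ D = 2 := by omega
    rcases hD with rfl | rfl | rfl | rfl | rfl <;>
      rcases hfd with ⟨h1, -, h1ne⟩ | ⟨h4, h23, -⟩ <;> omega
  haveI : NeZero D.natAbs := ⟨Int.natAbs_ne_zero.mpr h0⟩
  refine ⟨h0, not_assumptionA_of_re_ge_sqrt' _ h3 hlog ?_⟩
  rw [← LOne_eq_re h0, cast_natAbs_eq_abs']
  exact three_quarters_div_sqrt_le_LOne hfd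

/-! ## (A) for an arbitrary real primitive character of conductor `≤ e^{43149}` -/

/-- **Assumption (A) of arXiv:2211.02515 is false for EVERY primitive quadratic Dirichlet character `χ` of modulus
`1 < q` with `log q ≤ 43 149`** (`q ≤ e^{43149}`; the crossover of the trivial bound `h ≥ 1` is `log q* ≈ 43 159.67`): `χ`
is the Kronecker character `χ_D`, `D = χ(−1)q`, moved to level `q` (`changeLevel_kroneckerChar_eq`), `L(1,χ) = L(1,χ_D)`
(empty Euler correction), and `not_assumptionA_kroneckerChar_of_log_natAbs_le'`. The rescue bed's honesty rule H2 at the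
full range of `h ≥ 1`; nothing about (A) beyond it. [cite: Zhang2022LandauSiegel, §2 Assumption (A)]
[cite: MontgomeryVaughan2007, Theorem 9.13] -/
theorem not_assumptionA_of_isPrimitive_isQuadratic_of_log_le' {q : ℕ} [NeZero q] {χ : DirichletCharacter ℂ q}
    (hprim : χ.IsPrimitive) (hquad : χ.IsQuadratic) (h1 : 1 < q) (hlog : Real.log q ≤ 43149) :
    ¬ AssumptionA q χ := by
  obtain ⟨s, hpar, hs, hfd, hDq⟩ := exists_sign_fundamental hprim hquad h1
  have h0 : s * (q : ℤ) ≠ 0 := by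
    intro h; rw [h] at hDq; simp at hDq; exact (NeZero.ne q) hDq.symm
  haveI hne : NeZero (s * (q : ℤ)).natAbs := ⟨Int.natAbs_ne_zero.mpr h0⟩
  have hdvd : (s * (q : ℤ)).natAbs ∣ q := by rw [hDq]
  -- (1) χ is the Kronecker character moved to level q
  have hχ := changeLevel_kroneckerChar_eq hprim hquad hpar hfd hdvd hDq
  -- (2) the L-values agree (empty Euler correction)
  have hL : (changeLevel hdvd (kroneckerChar (s * q))).LFunction 1 = (kroneckerChar (s * q)).LFunction 1 := by
    rw [LFunction_changeLevel hdvd _ (Or.inl (kroneckerChar_ne_one hfd))]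
    have hprod : ∏ p ∈ q.primeFactors, (1 - kroneckerChar (s * q) (p : ZMod (s * (q : ℤ)).natAbs) *
        (p : ℂ) ^ (-(1 : ℂ))) = 1 := by
      refine Finset.prod_eq_one fun p hp => ?_
      have hpp : p.Prime := Nat.prime_of_mem_primeFactors hp
      have hpq : p ∣ (s * (q : ℤ)).natAbs := by rw [hDq]; exact Nat.dvd_of_mem_primeFactors hp
      have hnu : ¬ IsUnit ((p : ℕ) : ZMod (s * (q : ℤ)).natAbs) := by
        rw [ZMod.isUnit_prime_iff_not_dvd hpp]; exact fun h => h hpq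
      rw [MulChar.map_nonunit _ hnu, zero_mul, sub_zero]
    rw [hprod, mul_one]
  -- (3) the Kronecker character violates (A); transport
  obtain ⟨h0', hκ⟩ := not_assumptionA_kroneckerChar_of_log_natAbs_le' hfd (by rw [hDq]; exact hlog)
  intro hA
  apply hκ
  unfold AssumptionA at hA ⊢
  rw [← hL, hχ]
  have hcast : ((s * (q : ℤ)).natAbs : ℝ) = (q : ℝ) := by exact_mod_cast hDq
  rw [hcast]
  exact hA

end Literature.NumberTheory.LFunctions.Zhang2022.Repair.Bed.Vacuity
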